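import Mathlib
import HarnessLib
import Summits.HubbardSuperconductivity.HubbardSuperconductivity.Theorems.KLProgrammeH10TwoPointLimitPerturbedFermiRadiusSmooth
import Summits.HubbardSuperconductivity.HubbardSuperconductivity.Theorems.KLProgrammePerturbedFermiCurveDefs

/-!
# Route `KLProgramme` — K1/K3 (stmt-HubbardSuperconductivity-19938 / 20437), risk-register item 2 «Fermi-surface hypotheses on every
# admissible frame»: the perturbed Fermi radius is JOINTLY smooth in the angle and the level

Cell gate-hubbard-kl, seat p4 (C5a), g11.  Benfatto–Giuliani–Mastropietro 2003 §1.2 item 1 (typed as the field `smooth_u` of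
`FermiRG.BGM2003.DispersionHyp`, file `Literature/…/FermiRG/BGM2003Sectors.lean`) asks for the polar radius `u(θ, e)` of the level curves
`{ε = μ + e}` to be `C^∞` JOINTLY in `(θ, e)` on `𝕋¹ × (-e₁, e₁)`.  For the free band this is the tree's `contDiffOn_bandFermiRadius_uncurry`
(closed form); for the perturbed curves `{ε₀ + δ = ν}` of the lineage (`…PerturbedFermiRadiusSmooth`: `C^n` in the ANGLE at fixed level,
`contDiff_of_isRoot`) this file adds the level as a second parameter of the same implicit-function argument:

* `contDiff_pertLevel₂` — the two-parameter level function `G₂((θ, ν), t) = ε₀(t·dir θ) + δ(t·dir θ) − ν` is `Cⁿ`;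
* **`contDiffAt_perturbedFermiRadius_uncurry`** — for `δ ∈ Cⁿ` (`n ≥ 1`) with `|δ| ≤ κ₀`, `‖Dδ‖ ≤ κ₁ < Dt_min` on the closed square and a
  level `ν₀` with `a < ν₀ − κ₀`, `ν₀ + κ₀ < b`, the map `(θ, ν) ↦ perturbedFermiRadius δ ν θ` is `Cⁿ` at `(θ₀, ν₀)` (Mathlib's
  `ContDiffAt.implicitFunction` for `G₂` at the Fermi point — `∂_t G₂ ≥ Dt_min − κ₁ > 0` — identified with the canonical radius near
  `(θ₀, ν₀)` by ray-wise uniqueness `eq_perturbedFermiRadius_of_isBandFermiRadius`);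
* **`contDiffOn_perturbedFermiRadius_shell`** — hence `(θ, e) ↦ perturbedFermiRadius δ (μ + e) θ` is `Cⁿ` on `univ ×ˢ (-e₁, e₁)` whenever
  `a + κ₀ + e₁ ≤ μ ≤ b − κ₀ − e₁` — the `smooth_u` field of `DispersionHyp` for the curve of a frame.

Everything is PROVED; no definitions, no named facts.  References: BGM 2003 §1.2 item 1 [cite: BenfattoGiulianiMastropietro2003]; BGM 2006 §2.4
Lemma 2.1 (2.40) [cite: BenfattoGiulianiMastropietro2006].
-/

noncomputable section

namespace Summit.HubbardSuperconductivity.HubbardSuperconductivity.Theorems.PerturbedFermiCurve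

set_option linter.dupNamespace false -- summit = problem name (single-conjunct summit), D-0017

open Real Set Filter
open scoped Topology ContDiff
open Literature.MathematicalPhysics.QuantumLattice Literature.MathematicalPhysics.QuantumLattice.BandSectorCounting

/-! ## §1 The two-parameter level function -/

/-- **`G₂((θ, ν), t) = ε₀(t·dir θ) + δ(t·dir θ) − ν` is `Cⁿ` when `δ` is.** [folklore] -/
theorem contDiff_pertLevel₂ {δ : (Fin 2 → ℝ) → ℝ} {n : WithTop ℕ∞} (hδ : ContDiff ℝ n δ) :
    ContDiff ℝ n fun q : (ℝ × ℝ) × ℝ => rayDispersion (q.1.1, q.2) + δ (q.2 • dir q.1.1) - q.1.2 := by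
  have hL : ContDiff ℝ n fun q : (ℝ × ℝ) × ℝ => ((q.1.1, q.2) : ℝ × ℝ) := (contDiff_fst.comp contDiff_fst).prodMk contDiff_snd
  have h := (contDiff_pertLevel hδ).comp hL
  exact h.sub (contDiff_snd.comp contDiff_fst)

/-- The radial partial of `G₂` at `((θ, ν), t)` applied along `inr`: `c ↦ c·(∂_tF(θ,t) + Dδ(t·dir θ)[dir θ])`. [folklore] -/
theorem fderiv_pertLevel₂_inr {δ : (Fin 2 → ℝ) → ℝ} {n : WithTop ℕ∞} (hδ : ContDiff ℝ n δ) (hn : n ≠ 0) (θ ν t c : ℝ) :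
    (fderiv ℝ (fun q : (ℝ × ℝ) × ℝ => rayDispersion (q.1.1, q.2) + δ (q.2 • dir q.1.1) - q.1.2) ((θ, ν), t) ∘L
        ContinuousLinearMap.inr ℝ (ℝ × ℝ) ℝ) c =
      c * (rayDispersionDt θ t + fderiv ℝ δ (t • dir θ) (dir θ)) := by
  set G : (ℝ × ℝ) × ℝ → ℝ := fun q => rayDispersion (q.1.1, q.2) + δ (q.2 • dir q.1.1) - q.1.2 with hGdef
  have hGd : DifferentiableAt ℝ G ((θ, ν), t) := ((contDiff_pertLevel₂ hδ).differentiable hn) _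
  have hF : HasFDerivAt G (fderiv ℝ G ((θ, ν), t)) ((θ, ν), t) := hGd.hasFDerivAt
  have hg : HasDerivAt (fun s : ℝ => (((θ, ν), s) : (ℝ × ℝ) × ℝ)) (((0 : ℝ), (0 : ℝ)), (1 : ℝ)) t :=
    ((hasDerivAt_const t θ).prodMk (hasDerivAt_const t ν)).prodMk (hasDerivAt_id t)
  have hc : HasDerivAt (G ∘ fun s : ℝ => (((θ, ν), s) : (ℝ × ℝ) × ℝ)) (fderiv ℝ G ((θ, ν), t) ((0, 0), 1)) t :=
    HasFDerivAt.comp_hasDerivAt (l := G) (f := fun s : ℝ => (((θ, ν), s) : (ℝ × ℝ) × ℝ)) t hF hg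
  have hd : DifferentiableAt ℝ δ (t • dir θ) := (hδ.differentiable hn) _
  have hline : HasDerivAt (G ∘ fun s : ℝ => (((θ, ν), s) : (ℝ × ℝ) × ℝ))
      (rayDispersionDt θ t + fderiv ℝ δ (t • dir θ) (dir θ)) t := by
    have h := (hasDerivAt_pertLevel_radius (δ := δ) (θ := θ) hd).sub_const ν
    exact h
  have h1 : fderiv ℝ G ((θ, ν), t) ((0, 0), 1) = rayDispersionDt θ t + fderiv ℝ δ (t • dir θ) (dir θ) := hc.unique hline
  have hc1 : (((0 : ℝ × ℝ), c) : (ℝ × ℝ) × ℝ) = c • ((((0 : ℝ), (0 : ℝ)), (1 : ℝ)) : (ℝ × ℝ) × ℝ) := by ext <;> simp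
  rw [ContinuousLinearMap.comp_apply, ContinuousLinearMap.inr_apply, hc1, map_smul, h1, smul_eq_mul]

/-! ## §2 Joint smoothness of the perturbed Fermi radius in the angle and the level -/

section Joint

variable {a b : ℝ} (B : BandBounds a b) {δ : (Fin 2 → ℝ) → ℝ} {n : WithTop ℕ∞} (hδs : ContDiff ℝ n δ) (hn : n ≠ 0)
  {κ₀ κ₁ : ℝ} (hδ : ∀ k : Fin 2 → ℝ, (∀ i, |k i| ≤ π) → |δ k| ≤ κ₀)
  (hκ : ∀ k : Fin 2 → ℝ, (∀ i, |k i| ≤ π) → ‖fderiv ℝ δ k‖ ≤ κ₁) (hκ₁ : κ₁ < B.Dtmin)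
include B hδs hn hδ hκ hκ₁

/-- **The perturbed Fermi radius is `Cⁿ` jointly in the angle and the level**: for `δ ∈ Cⁿ` (`n ≥ 1`) with `|δ| ≤ κ₀`,
`‖Dδ‖ ≤ κ₁ < Dt_min` on the closed square and a level `ν₀` with `a < ν₀ − κ₀`, `ν₀ + κ₀ < b`, the map `(θ, ν) ↦ perturbedFermiRadius δ ν θ`
is `Cⁿ` at `(θ₀, ν₀)`. [cite: BenfattoGiulianiMastropietro2006, §2.4 Lemma 2.1 (2.40)] -/
theorem contDiffAt_perturbedFermiRadius_uncurry {ν₀ : ℝ} (hlo : a < ν₀ - κ₀) (hhi : ν₀ + κ₀ < b) (θ₀ : ℝ) :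
    ContDiffAt ℝ n (fun p : ℝ × ℝ => perturbedFermiRadius δ p.2 p.1) (θ₀, ν₀) := by
  have hδc : Continuous δ := hδs.continuous
  have hdiffδ : ∀ k, DifferentiableAt ℝ δ k := fun k => (hδs.differentiable hn) k
  set G : (ℝ × ℝ) × ℝ → ℝ := fun q => rayDispersion (q.1.1, q.2) + δ (q.2 • dir q.1.1) - q.1.2 with hGdef
  set u₂ : ℝ × ℝ → ℝ := fun p => perturbedFermiRadius δ p.2 p.1 with hu₂
  -- the canonical radius is a Fermi point at every admissible level
  have hroot : ∀ p : ℝ × ℝ, a ≤ p.2 - κ₀ → p.2 + κ₀ ≤ b →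
      IsBandFermiRadius (p.2 - δ (u₂ p • dir p.1)) p.1 (u₂ p) := fun p h1 h2 =>
    isBandFermiRadius_perturbedFermiRadius B hδc hδ h1 h2 p.1
  have hroot₀ := hroot (θ₀, ν₀) hlo.le hhi.le
  have cdf : ContDiffAt ℝ n G ((θ₀, ν₀), u₂ (θ₀, ν₀)) := (contDiff_pertLevel₂ hδs).contDiffAt
  -- the `t`-partial is invertible
  have hGt : 0 < rayDispersionDt θ₀ (u₂ (θ₀, ν₀)) + fderiv ℝ δ (u₂ (θ₀, ν₀) • dir θ₀) (dir θ₀) :=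
    pertDt_pos B hδ hlo.le hhi.le hκ hκ₁ (u := fun θ => u₂ (θ, ν₀)) (fun θ => hroot (θ, ν₀) hlo.le hhi.le) θ₀
  have hinr : ∀ c : ℝ, (fderiv ℝ G ((θ₀, ν₀), u₂ (θ₀, ν₀)) ∘L ContinuousLinearMap.inr ℝ (ℝ × ℝ) ℝ) c =
      c * (rayDispersionDt θ₀ (u₂ (θ₀, ν₀)) + fderiv ℝ δ (u₂ (θ₀, ν₀) • dir θ₀) (dir θ₀)) :=
    fun c => fderiv_pertLevel₂_inr hδs hn θ₀ ν₀ (u₂ (θ₀, ν₀)) c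
  have if₂ : (fderiv ℝ G ((θ₀, ν₀), u₂ (θ₀, ν₀)) ∘L ContinuousLinearMap.inr ℝ (ℝ × ℝ) ℝ).IsInvertible := by
    refine ⟨ContinuousLinearEquiv.unitsEquivAut ℝ (Units.mk0 _ hGt.ne'), ContinuousLinearMap.ext_ring ?_⟩
    rw [ContinuousLinearEquiv.coe_coe, ContinuousLinearEquiv.unitsEquivAut_apply, Units.val_mk0, hinr, one_mul]
  -- the implicit function at `((θ₀, ν₀), u₂ (θ₀, ν₀))`
  have hψ : ContDiffAt ℝ n (cdf.implicitFunction hn if₂) (θ₀, ν₀) := cdf.contDiffAt_implicitFunction hn if₂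
  have hψ0 : cdf.implicitFunction hn if₂ (θ₀, ν₀) = u₂ (θ₀, ν₀) := cdf.implicitFunction_apply_self hn if₂
  have hψeq : ∀ᶠ p in 𝓝 (θ₀, ν₀), G (p, cdf.implicitFunction hn if₂ p) = G ((θ₀, ν₀), u₂ (θ₀, ν₀)) :=
    cdf.eventually_apply_implicitFunction hn if₂
  have hG0 : G ((θ₀, ν₀), u₂ (θ₀, ν₀)) = 0 := by
    show rayDispersion (θ₀, u₂ (θ₀, ν₀)) + δ (u₂ (θ₀, ν₀) • dir θ₀) - ν₀ = 0
    linarith [hroot₀.2]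
  -- its values stay inside the open ray segment, and the level stays admissible, near `(θ₀, ν₀)`
  have hI := mem_Ioo_of_shifted B hδ hlo.le hhi.le hroot₀
  have hψc : ContinuousAt (cdf.implicitFunction hn if₂) (θ₀, ν₀) := hψ.continuousAt
  have hev1 : ∀ᶠ p in 𝓝 (θ₀, ν₀), 0 < cdf.implicitFunction hn if₂ p :=
    hψc.eventually (lt_mem_nhds (by rw [hψ0]; exact hI.1))
  have hexitc : Continuous fun p : ℝ × ℝ => π / ‖dir p.1‖ :=
    continuous_const.div (continuous_norm_dir.comp continuous_fst) fun p => (norm_dir_pos p.1).ne'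
  have hev2 : ∀ᶠ p in 𝓝 (θ₀, ν₀), 0 < π / ‖dir p.1‖ - cdf.implicitFunction hn if₂ p :=
    (hexitc.continuousAt.sub hψc).eventually
      (lt_mem_nhds (show (0 : ℝ) < π / ‖dir θ₀‖ - cdf.implicitFunction hn if₂ (θ₀, ν₀) by
        rw [hψ0]; linarith [hI.2]))
  have hev3 : ∀ᶠ p : ℝ × ℝ in 𝓝 (θ₀, ν₀), a < p.2 - κ₀ ∧ p.2 + κ₀ < b := by
    have hc2 : ContinuousAt (fun p : ℝ × ℝ => p.2) (θ₀, ν₀) := continuous_snd.continuousAt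
    have h1 : ∀ᶠ p : ℝ × ℝ in 𝓝 (θ₀, ν₀), a + κ₀ < p.2 := hc2.eventually (lt_mem_nhds (by simpa using by linarith))
    have h2 : ∀ᶠ p : ℝ × ℝ in 𝓝 (θ₀, ν₀), p.2 < b - κ₀ := hc2.eventually (gt_mem_nhds (by simpa using by linarith))
    filter_upwards [h1, h2] with p hp1 hp2
    exact ⟨by linarith, by linarith⟩
  -- so by ray-wise uniqueness the implicit function IS the canonical radius near `(θ₀, ν₀)`
  have heq : u₂ =ᶠ[𝓝 (θ₀, ν₀)] cdf.implicitFunction hn if₂ := by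
    filter_upwards [hψeq, hev1, hev2, hev3] with p hp h1 h2 h3
    have hψroot : IsBandFermiRadius (p.2 - δ (cdf.implicitFunction hn if₂ p • dir p.1)) p.1 (cdf.implicitFunction hn if₂ p) := by
      refine ⟨⟨h1.le, ?_⟩, ?_⟩
      · rw [← le_div_iff₀ (norm_dir_pos p.1)]; linarith
      · show rayDispersion (p.1, cdf.implicitFunction hn if₂ p) = p.2 - δ (cdf.implicitFunction hn if₂ p • dir p.1)
        have : rayDispersion (p.1, cdf.implicitFunction hn if₂ p) + δ (cdf.implicitFunction hn if₂ p • dir p.1) - p.2 = 0 := by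
          rw [← hG0]; exact hp
        linarith
    exact (eq_perturbedFermiRadius_of_isBandFermiRadius B hδc hδ h3.1.le h3.2.le
      (radialLipschitz_of_fderiv_le (fun k _ => hdiffδ k) hκ p.1) hκ₁ hψroot).symm ▸ rfl
  exact hψ.congr_of_eventuallyEq heq

/-- **The `smooth_u` field for the curve of a frame**: `(θ, e) ↦ perturbedFermiRadius δ (μ + e) θ` is `Cⁿ` on `univ ×ˢ (-e₁, e₁)` whenever
`a + κ₀ + e₁ ≤ μ` and `μ + κ₀ + e₁ ≤ b`. [cite: BenfattoGiulianiMastropietro2003, §1.2 item 1] -/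
theorem contDiffOn_perturbedFermiRadius_shell {μ e₁ : ℝ} (hlo : a + κ₀ + e₁ ≤ μ) (hhi : μ + κ₀ + e₁ ≤ b) :
    ContDiffOn ℝ n (Function.uncurry fun θ e => perturbedFermiRadius δ (μ + e) θ) (univ ×ˢ Ioo (-e₁) e₁) := by
  intro p hp
  obtain ⟨-, hp2⟩ := hp
  have h1 : a < μ + p.2 - κ₀ := by linarith [hp2.1]
  have h2 : μ + p.2 + κ₀ < b := by linarith [hp2.2]
  have hA := contDiffAt_perturbedFermiRadius_uncurry B hδs hn hδ hκ hκ₁ h1 h2 p.1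
  have hg : ContDiff ℝ n (fun q : ℝ × ℝ => ((q.1, μ + q.2) : ℝ × ℝ)) := contDiff_fst.prodMk (contDiff_const.add contDiff_snd)
  have hcomp : ContDiffAt ℝ n ((fun p : ℝ × ℝ => perturbedFermiRadius δ p.2 p.1) ∘ fun q : ℝ × ℝ => ((q.1, μ + q.2) : ℝ × ℝ)) p :=
    hA.comp p hg.contDiffAt
  exact hcomp.contDiffWithinAt

end Joint

end Summit.HubbardSuperconductivity.HubbardSuperconductivity.Theorems.PerturbedFermiCurve

end
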